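import Summits.ABC.IUTFork.Joshi.Holomorphoids
import Summits.ABC.IUTFork.Joshi.ArithmeticoidPeriods
import Summits.ABC.IUTFork.Joshi.ArithmeticoidProperties
import HarnessLib

/-!
# [J-III] §2 holomorphoids over the [J2h] arithmeticoid carrier of record — the merge `ATS2h.DeformationDatum → ATS3.ArithFFDatum`

Block E of the abc-iut cell (rung LADDER-ABC:A2.E; seat abc-iut-E-t5, slot T-05; plan/E/ASSIGNMENTS.md §3 open carrier debt
«`ArithFFDatum` ↔ E-t37's J2h carriers»). FRAMING: unrefereed preprints typed as signatures; typed ≠ proved; typed AS A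
CANDIDATE ≠ endorsed; NO SIDE taken on [IUTchIII] Cor. 3.12 or on any author; no abc claim.

WHAT IS HERE (all DERIVED; no new hypothesis, no claim, nothing asserted). The adelic signature of `Joshi/Holomorphoids.lean`
(`ATS3.ArithFFDatum`, p431320; [J-III] = arXiv:2401.13508v4 §2.1 citing [J2h] = arXiv:2305.10398 Def. 4.1.1 / 5.1.1 / §5.3) was
filed under the INTERIM CARRIER RULE before E-t37's carrier of record for [J2h] §4–§5 landed (`ATS2h.DeformationDatum`,
`Joshi/Arithmeticoids.lean` p430482, with `ArithmeticoidPeriods` p430897 and `ArithmeticoidProperties` p430871). This file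
PAYS that merge-debt by a kernel map and three identities:
* `ArithFFDatum.ofDeformation D h` — the forgetful map: same places `V`, points `|Y_{F_v,L_v}|`, completions `L_v`, residue
  fields `K_y`, embeddings `L ↪ L_v ↪ K_y`; the valuation `|−|_{K_y}` of `DeformationDatum` is a [J2h] §2.3 (Bourbaki) valued
  field (weak triangle inequality `|x+y| ≤ A·max`), whereas `ArithFFDatum.absK` is a Mathlib `AbsoluteValue`, so the map takes
  the ordinary triangle inequality as an explicit hypothesis `h : TriangleValued D` (satisfied by the non-archimedean
  `|−|_{K_y}` and by `|−|_ℂ`; NOT by `|−|_ℂ^s`, `s > 1` — the one place the two signatures differ, recorded). `DeformationDatum`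
  records WHICH tilt is used (`base : TiltBase`) but no tilt carriers, so the tilt fields are set to the one-point type —
  stated, not hidden.
* `NormalizedArithmeticoid.ofDeformation D h y` — every arithmeticoid `y ∈ 𝒴_L` of `D` is NORMALIZED in the sense of [J-III]
  (2.1.1): the product formula `∏ᶠ_v |ι_y(x)|^{α_v(y_v)}_{K_{y_v}} = 1` (`x ∈ L*`) is PROVED from E-t37's derived (5.3.4)
  `prod_formula_normalized` (`Σᶠ_v α_v·log|ι_y(x)| = 0`) and `finite_absK_iota_ne_one` — exp/log bookkeeping only.
* `isTopEquivalent_ofDeformation_iff` / `existTopInequivalent_ofDeformation_iff` — [J2h] Def. 5.2.1 and Thm. 5.5.2 (7) typed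
  twice (`ArithFFDatum.IsTopEquivalent` / `.ExistTopInequivalentArithmeticoids` here, `DeformationDatum.TopEquivalent` /
  `.Thm552_7` there) AGREE definitionally on the image of the map.
Hence every [J-III] §2 object of `Holomorphoids.lean` (`GlobalHolomorphoid`, `LocalHolomorphoid`, the categories `HolOver`,
`HolCat`) is available over E-t37's datum through `ArithFFDatum.ofDeformation`. Inputs BY NAME only; nothing restated.
-/

noncomputable section

namespace Summit.ABC.IUTFork.Joshi.ATS3

open ATS2h

variable {L : Type} [Field L] {V : Type} {Lv : V → Type} [∀ v, Field (Lv v)] {Y : V → Type}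
  [∀ v, TopologicalSpace (Y v)] {K : (v : V) → Y v → Type} [∀ v y, Field (K v y)] [∀ v y, TopologicalSpace (K v y)]
  {Gal : V → Type} [∀ v, Group (Gal v)] {Aut : V → Type} [∀ v, Group (Aut v)]
  (D : DeformationDatum L V Lv Y K Gal Aut)

/-- The ordinary triangle inequality for every residue-field valuation `|−|_{K_y}` of the deformation datum ([J2h] §2.3
allows the weaker Bourbaki axiom `|x + y| ≤ A·max(|x|,|y|)`; Mathlib's `AbsoluteValue`, used by `ArithFFDatum.absK`, wants
`A`-free subadditivity). Hypothesis of the merge map; holds for non-archimedean `|−|_{K_y}` and for `|−|_ℂ`.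
[claim: Joshi2024ATS3, status: disputed] -/
def TriangleValued : Prop :=
  ∀ (v : V) (y : Y v) (a b : K v y), D.absK v y (a + b) ≤ D.absK v y a + D.absK v y b

/-- `|−|_{K_y}` of the deformation datum as a Mathlib `AbsoluteValue` (multiplicativity, non-negativity and definiteness from
E-t37's `IsValuedField`, subadditivity from the hypothesis). [folklore] -/
def absKAbs (h : TriangleValued D) (v : V) (y : Y v) : AbsoluteValue (K v y) ℝ where
  toFun := D.absK v y
  map_mul' := (D.absK_isValuedField v y).map_mul
  nonneg' := (D.absK_isValuedField v y).nonneg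
  eq_zero' x := (D.absK_isValuedField v y).eq_zero_iff x
  add_le' := h v y

/-- `absKAbs` is `|−|_{K_y}`. [folklore] -/
@[simp] theorem absKAbs_apply (h : TriangleValued D) (v : V) (y : Y v) (a : K v y) :
    absKAbs D h v y a = D.absK v y a := rfl

/-- **The merge map** `ATS2h.DeformationDatum → ATS3.ArithFFDatum` ([J2h] Def. 4.1.1 / 5.1.1 typed by E-t37 ↦ the adelic
signature [J-III] §2.1 uses): places, points of `|Y_{F_v,L_v}|`, completions, residue fields and the embeddings
`L → L_v ↪ K_y` are carried over verbatim; `|−|_{K_y}` becomes an `AbsoluteValue` under `h`; the tilt carriers are the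
one-point type (`DeformationDatum` records the choice of tilt base `D.base : TiltBase`, not the tilts). DERIVED (a
definition over E-t37's signature). [claim: Joshi2024ATS3, status: disputed] -/
def ArithFFDatum.ofDeformation (h : TriangleValued D) : ArithFFDatum L where
  V := V
  Y := Y
  Lv := Lv
  toLv := D.toLv
  K := K
  emb := D.emb
  absK := absKAbs D h
  tilt _ _ := PUnit
  fixedTilt _ := PUnit
  tiltIso _ _ := Equiv.refl PUnit

variable (h : TriangleValued D)

/-- The points `𝒴_L` of the image signature are E-t37's arithmeticoids `D.Arith = ∏_v |Y_{F_v,L_v}|` — the same type.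
[folklore] -/
theorem points_ofDeformation : (ArithFFDatum.ofDeformation D h).Points = D.Arith := rfl

/-- The induced valuation on `L` of the image signature is E-t37's `|ι_{y_v}(x)|_{K_{y_v}}` ([J2h] Lem. 5.1.3's `ι_L`).
[folklore] -/
theorem absAt_ofDeformation (y : D.Arith) (v : V) (x : L) :
    (ArithFFDatum.ofDeformation D h).absAt y v x = D.absK v (y v) (D.iota y v x) := rfl

/-- **Every arithmeticoid of a deformation datum is normalized in the sense of [J-III] (2.1.1)** ([J-III] §2.1 p.19
l.28–36 «all arithmeticoids `arith(L)_y` are normalized»; [J2h] (5.3.4)): with `α_v := α_v(y_v)` (E-t37's normalization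
coordinate), `∏ᶠ_v |ι_y(x)|^{α_v}_{K_{y_v}} = 1` for `x ∈ L*`. DERIVED from E-t37's `prod_formula_normalized`
(`Σᶠ_v α_v·log|ι_y(x)|_{K_{y_v}} = 0`), `absK_iota_pos` and `finite_absK_iota_ne_one` by `exp`/`log`. [folklore] -/
def NormalizedArithmeticoid.ofDeformation (y : D.Arith) :
    (ArithFFDatum.ofDeformation D h).NormalizedArithmeticoid where
  point := y
  α v := D.α v (y v)
  α_pos v := D.α_pos v (y v)
  finite_support x hx := by
    refine (D.finite_absK_iota_ne_one y (Units.mk0 x hx)).subset fun v hv h1 => hv ?_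
    show D.absK v (y v) (D.iota y v (Units.mk0 x hx)) ^ D.α v (y v) = 1
    rw [h1, Real.one_rpow]
  prod_formula x hx := by
    have hpos : ∀ v, 0 < D.absK v (y v) (D.iota y v (Units.mk0 x hx)) := fun v =>
      D.absK_iota_pos y v (Units.mk0 x hx)
    have hfin := D.finite_absK_iota_ne_one y (Units.mk0 x hx)
    show ∏ᶠ v, D.absK v (y v) (D.iota y v (Units.mk0 x hx)) ^ D.α v (y v) = 1
    have hsub : (Function.mulSupport fun v => D.absK v (y v) (D.iota y v (Units.mk0 x hx)) ^ D.α v (y v)) ⊆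
        (hfin.toFinset : Set V) := by
      intro v hv
      rw [Set.Finite.coe_toFinset]
      intro h1
      exact hv (by simp only [h1, Real.one_rpow])
    have hsub' : (Function.support fun v => D.α v (y v) * Real.log (D.absK v (y v) (D.iota y v (Units.mk0 x hx)))) ⊆
        (hfin.toFinset : Set V) := by
      intro v hv
      rw [Set.Finite.coe_toFinset]
      intro h1
      exact hv (by simp only [h1, Real.log_one, mul_zero])
    rw [finprod_eq_prod_of_mulSupport_subset _ hsub]
    have hprodpos : 0 < ∏ v ∈ hfin.toFinset, D.absK v (y v) (D.iota y v (Units.mk0 x hx)) ^ D.α v (y v) :=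
      Finset.prod_pos fun v _ => Real.rpow_pos_of_pos (hpos v) _
    have hlog : Real.log (∏ v ∈ hfin.toFinset, D.absK v (y v) (D.iota y v (Units.mk0 x hx)) ^ D.α v (y v)) = 0 := by
      rw [Real.log_prod (fun v _ => (Real.rpow_pos_of_pos (hpos v) _).ne')]
      simp_rw [Real.log_rpow (hpos _)]
      rw [← finsum_eq_sum_of_support_subset _ hsub']
      exact D.prod_formula_normalized y (Units.mk0 x hx)
    rw [← Real.exp_log hprodpos, hlog, Real.exp_zero]

/-- The normalized arithmeticoid so obtained sits over the given point `y`. [folklore] -/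
theorem NormalizedArithmeticoid.ofDeformation_point (y : D.Arith) :
    (NormalizedArithmeticoid.ofDeformation D h y).point = y := rfl

/-- [J2h] Def. 5.2.1 typed twice, identically: topological equivalence of arithmeticoids in the image signature IS E-t37's
`DeformationDatum.TopEquivalent`. [folklore] -/
theorem isTopEquivalent_ofDeformation_iff (y₁ y₂ : D.Arith) :
    (ArithFFDatum.ofDeformation D h).IsTopEquivalent y₁ y₂ ↔ D.TopEquivalent y₁ y₂ := Iff.rfl

/-- [J2h] Thm. 5.5.2 (7) typed twice, identically: the reading predicate `ExistTopInequivalentArithmeticoids` of the image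
signature IS E-t37's `DeformationDatum.Thm552_7`. [folklore] -/
theorem existTopInequivalent_ofDeformation_iff :
    (ArithFFDatum.ofDeformation D h).ExistTopInequivalentArithmeticoids ↔ D.Thm552_7 := Iff.rfl

end Summit.ABC.IUTFork.Joshi.ATS3

end
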